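import Summits.CriticalPhenomena.PercolationContinuityZ3.Theorems.PercNearOneGluingNearOneGluingPivotalityDomination
import HarnessLib

/-! # Crux `PercNearOneGluing.AdditiveGluing` (stmt-CriticalPhenomena-4576), line `peel`, stub `stub_pairGamma` —
# the relay-exchange inequalities of the pair step (strategy (b), correlation inequalities)

Support file (`--supports stmt-CriticalPhenomena-4576`); no definitions, no named facts.

`μ = prodBernoulli u` on the bond configurations of the complete weighted graph `Fin n`; `b` the target, `a₁, a₂` two relays.
The EXCHANGE form of Kozma–Nitzan's Lemma 3(i): if `μ(a₁ ↔ b) ≤ μ(a₂ ↔ b) + d` and `Q` is increasing and determined by the open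
edge cluster of `a₂`, then removing the common part `{a₁ ↔ b} ∩ {a₂ ↔ b} ∩ Q` from the landed `knLemma3i` gives
* `pairStepRelayExchange_of_le`:  `μ(Q, a₁ ↔ b, a₂ ↮ b) ≤ μ(Q, a₂ ↔ b, a₁ ↮ b) + d · μ(Q)`  ("`a₁` beats `a₂` on `Q` by at most `d·μ(Q)`").
Two instances used by the pair step `K(s)·Z(S) ≤ K(S)·Z(s)` (`S = {s, x}`, designated relay `a₀ = argmin_A μ(· ↔ b)`):
* `pairStepRelayExchange_hijack` (`Q = {x ∈ C(a₀)}`, `d` = the reliability gap `μ(a₁↔b) − μ(a₀↔b) ≥ 0`): the HIJACK EXCHANGE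
  `μ(x ↔ a₀, a₁ ↔ b, a₀ ↮ b) ≤ μ(x ↔ a₀, a₀ ↔ b, a₁ ↮ b) + (μ(a₁↔b) − μ(a₀↔b)) · μ(x ↔ a₀)`, equivalently
  `Cov(1{x↔a₀}, 1{a₁↔b}) ≤ Cov(1{x↔a₀}, 1{a₀↔b})` — conditioning on `x ∈ C(a₀)` does not increase the advantage of `a₁` over the
  designated relay.  It is the exact first-order content of the pair step on the lo-heavy family "`s` pendant on `a₁`" (crux evidence
  `CorrIneq-b.md` §3(a): there the pair step is this inequality plus Harris `μ(a₀↔b)μ(x↔a₀) ≤ μ(x↔b)`), i.e. the `y = relay` linear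
  coefficient of CONTROL-CENSUS C24; numerically sharp (an identity on `x` pendant on `a₀`, false for negative gap).
* `pairStepRelayExchange_deficit`: the same with the right-hand event enlarged to `{x ↔ b, a₁ ↮ b, a₁ ↮ a₀}` (the form in which it is
  consumed: `E ⊇ Hij'`).
* `pairStepRelayExchange_upset` (`d = 0`): for the designated relay `a₀` and ANY increasing event `Q` determined by the open edge cluster
  of another relay `a₁` — e.g. `Q = {s ∈ C(a₁)} ∩ {C(a₁) ∈ 𝒰}` for an up-set `𝒰` of vertex sets — the localised exchange slack is
  nonnegative: `μ(Q, a₀ ↔ b, a₁ ↮ b) ≤ μ(Q, a₁ ↔ b, a₀ ↮ b)` (the `e(𝒰) ≥ 0` of `CorrIneq-b.md` §3(c)).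
[cite: KozmaNitzan2024, Lemma 3(i) (pp. 6–7), §3.2 pp. 12–14; VandenbergHaggstromKahn2005, Thm. 1.3 (p. 6), Thm. 1.4 (p. 7)]
-/

namespace Summit.CriticalPhenomena.PercolationContinuityZ3.Theorems

open MeasureTheory Set
open Literature.Probability.LatticeModels (prodBernoulli)
open Literature.Probability.Percolation (BondConfig openConn openEdgeCluster)

noncomputable section
open Classical

section PairStepRelayExchange

open Literature.Probability.LatticeModels Literature.Probability.Percolation

variable {n : ℕ}

/-- **Exchange form of KN Lemma 3(i).**  If `μ(a₁ ↔ b) ≤ μ(a₂ ↔ b) + d` (`d ≥ 0`) and `Q` is increasing and determined by the open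
edge cluster of `a₂`, then `μ(Q ∩ {a₁ ↔ b} ∩ {a₂ ↮ b}) ≤ μ(Q ∩ {a₂ ↔ b} ∩ {a₁ ↮ b}) + d · μ(Q)`: the landed `knLemma3i` with the
common part `Q ∩ {a₁ ↔ b} ∩ {a₂ ↔ b}` removed from both sides. [cite: KozmaNitzan2024, Lemma 3(i) (pp. 6–7)] -/
theorem pairStepRelayExchange_of_le (u : Sym2 (Fin n) → unitInterval) (a₁ a₂ b : Fin n)
    (Q : Set (BondConfig (Fin n))) (d : ℝ)
    (hQ : ∀ ω ω', ω ∈ Q → openEdgeCluster ω a₂ ⊆ openEdgeCluster ω' a₂ → ω' ∈ Q)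
    (hd : 0 ≤ d)
    (hle : (prodBernoulli u).real (openConn a₁ b) ≤ (prodBernoulli u).real (openConn a₂ b) + d) :
    (prodBernoulli u).real (Q ∩ openConn a₁ b ∩ (openConn a₂ b)ᶜ) ≤
      (prodBernoulli u).real (Q ∩ openConn a₂ b ∩ (openConn a₁ b)ᶜ) + d * (prodBernoulli u).real Q := by
  have h := knLemma3i n u a₁ a₂ b Q d hQ hd hle
  have hmeas : ∀ s : Set (BondConfig (Fin n)), MeasurableSet s := fun _ => MeasurableSet.of_discrete
  have h1 := measureReal_inter_add_sdiff (μ := prodBernoulli u) (s := openConn a₁ b ∩ Q) (hmeas (openConn a₂ b))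
  have h2 := measureReal_inter_add_sdiff (μ := prodBernoulli u) (s := openConn a₂ b ∩ Q) (hmeas (openConn a₁ b))
  have hc : (openConn a₁ b ∩ Q) ∩ openConn a₂ b = (openConn a₂ b ∩ Q) ∩ openConn a₁ b := by
    ext ω
    simp only [Set.mem_inter_iff]
    tauto
  have hd1 : (openConn a₁ b ∩ Q) \ openConn a₂ b = Q ∩ openConn a₁ b ∩ (openConn a₂ b)ᶜ := by
    ext ω
    simp only [Set.mem_sdiff, Set.mem_inter_iff, Set.mem_compl_iff]
    tauto
  have hd2 : (openConn a₂ b ∩ Q) \ openConn a₁ b = Q ∩ openConn a₂ b ∩ (openConn a₁ b)ᶜ := by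
    ext ω
    simp only [Set.mem_sdiff, Set.mem_inter_iff, Set.mem_compl_iff]
    tauto
  rw [hc, hd1] at h1
  rw [hd2] at h2
  linarith

/-- **The hijack exchange of the pair step** (`Q = {x ∈ C(a₀)}`, `d` = the gap of the designated relay `a₀` below `a₁`): if
`μ(a₀ ↔ b) ≤ μ(a₁ ↔ b)` then
`μ(x ↔ a₀, a₁ ↔ b, a₀ ↮ b) ≤ μ(x ↔ a₀, a₀ ↔ b, a₁ ↮ b) + (μ(a₁ ↔ b) − μ(a₀ ↔ b)) · μ(x ↔ a₀)`,
i.e. `Cov(1{x↔a₀}, 1{a₁↔b}) ≤ Cov(1{x↔a₀}, 1{a₀↔b})`.  KN Lemma 3(i) at the bystander event `{x ∈ C(a₀)}`, which is increasing and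
determined by the open edge cluster of `a₀` (`pivDom_openConn_mono_openEdgeCluster`).
[cite: KozmaNitzan2024, Lemma 3(i) (pp. 6–7), §3.2 pp. 12–14] -/
theorem pairStepRelayExchange_hijack (u : Sym2 (Fin n) → unitInterval) (a₀ a₁ b x : Fin n)
    (hle : (prodBernoulli u).real (openConn a₀ b) ≤ (prodBernoulli u).real (openConn a₁ b)) :
    (prodBernoulli u).real (openConn a₀ x ∩ openConn a₁ b ∩ (openConn a₀ b)ᶜ) ≤
      (prodBernoulli u).real (openConn a₀ x ∩ openConn a₀ b ∩ (openConn a₁ b)ᶜ)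
        + ((prodBernoulli u).real (openConn a₁ b) - (prodBernoulli u).real (openConn a₀ b))
          * (prodBernoulli u).real (openConn a₀ x) := by
  have hd : 0 ≤ (prodBernoulli u).real (openConn a₁ b) - (prodBernoulli u).real (openConn a₀ b) := by linarith
  exact pairStepRelayExchange_of_le u a₁ a₀ b (openConn a₀ x) _
    (pivDom_openConn_mono_openEdgeCluster a₀ x) hd (by linarith)

/-- **The hijack exchange, deficit form.**  Under `μ(a₀ ↔ b) ≤ μ(a₁ ↔ b)`:
`μ(x ↔ a₀, a₁ ↔ b, a₀ ↮ b) ≤ μ(x ↔ b, a₁ ↮ b, a₁ ↮ a₀) + (μ(a₁ ↔ b) − μ(a₀ ↔ b)) · μ(x ↔ a₀)` — the event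
`{x ↔ a₀ ↔ b, a₁ ↮ b}` of `pairStepRelayExchange_hijack` lies in `{x ↔ b, a₁ ↮ b, a₁ ↮ a₀}`.  On the family "`s` pendant on `a₁`"
the pair step of line `peel` is exactly this inequality plus Harris. [cite: KozmaNitzan2024, Lemma 3(i) (pp. 6–7), §3.2 pp. 12–14] -/
theorem pairStepRelayExchange_deficit (u : Sym2 (Fin n) → unitInterval) (a₀ a₁ b x : Fin n)
    (hle : (prodBernoulli u).real (openConn a₀ b) ≤ (prodBernoulli u).real (openConn a₁ b)) :
    (prodBernoulli u).real (openConn a₀ x ∩ openConn a₁ b ∩ (openConn a₀ b)ᶜ) ≤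
      (prodBernoulli u).real (openConn x b ∩ (openConn a₁ b)ᶜ ∩ (openConn a₁ a₀)ᶜ)
        + ((prodBernoulli u).real (openConn a₁ b) - (prodBernoulli u).real (openConn a₀ b))
          * (prodBernoulli u).real (openConn a₀ x) := by
  have h := pairStepRelayExchange_hijack u a₀ a₁ b x hle
  have hsub : (openConn a₀ x ∩ openConn a₀ b ∩ (openConn a₁ b)ᶜ : Set (BondConfig (Fin n))) ⊆
      openConn x b ∩ (openConn a₁ b)ᶜ ∩ (openConn a₁ a₀)ᶜ := by
    rintro ω ⟨⟨hx, h0⟩, h1⟩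
    refine ⟨⟨?_, h1⟩, fun h10 => h1 ?_⟩
    · exact SimpleGraph.Reachable.trans (SimpleGraph.Reachable.symm hx) h0
    · exact SimpleGraph.Reachable.trans h10 h0
  have hmono := measureReal_mono (μ := prodBernoulli u) hsub
  linarith

/-- **Localised exchange slack is nonnegative** (`d = 0`): for the designated relay `a₀` (`μ(a₀ ↔ b) ≤ μ(a₁ ↔ b)`) and any event `Q`
increasing and determined by the open edge cluster of `a₁` — e.g. `{s ∈ C(a₁)} ∩ {C(a₁) ∈ 𝒰}` for an up-set `𝒰` of vertex sets —
`μ(Q, a₀ ↔ b, a₁ ↮ b) ≤ μ(Q, a₁ ↔ b, a₀ ↮ b)`: on `Q`, the live-fail mass behind `a₀` is at most the winning mass of `a₁`.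
[cite: KozmaNitzan2024, Lemma 3(i) (pp. 6–7)] -/
theorem pairStepRelayExchange_upset (u : Sym2 (Fin n) → unitInterval) (a₀ a₁ b : Fin n)
    (Q : Set (BondConfig (Fin n)))
    (hQ : ∀ ω ω', ω ∈ Q → openEdgeCluster ω a₁ ⊆ openEdgeCluster ω' a₁ → ω' ∈ Q)
    (hle : (prodBernoulli u).real (openConn a₀ b) ≤ (prodBernoulli u).real (openConn a₁ b)) :
    (prodBernoulli u).real (Q ∩ openConn a₀ b ∩ (openConn a₁ b)ᶜ) ≤
      (prodBernoulli u).real (Q ∩ openConn a₁ b ∩ (openConn a₀ b)ᶜ) := by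
  have h := pairStepRelayExchange_of_le u a₀ a₁ b Q 0 hQ le_rfl (by linarith)
  simpa using h

/-- Registered rung `stub_pairStepRelayExchange_b` of crux stmt-CriticalPhenomena-4576 (seat b, correlation inequalities): the hijack
exchange `μ(x ↔ a₀, a₁ ↔ b, a₀ ↮ b) ≤ μ(x ↔ a₀, a₀ ↔ b, a₁ ↮ b) + (μ(a₁↔b) − μ(a₀↔b))·μ(x ↔ a₀)` under `μ(a₀↔b) ≤ μ(a₁↔b)` —
`pairStepRelayExchange_hijack`, closed statement. [cite: KozmaNitzan2024, Lemma 3(i) (pp. 6–7)] -/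
theorem stub_pairStepRelayExchange_b : ∀ (n : ℕ) (u : Sym2 (Fin n) → unitInterval) (a₀ a₁ b x : Fin n), (Literature.Probability.LatticeModels.prodBernoulli u).real (Literature.Probability.Percolation.openConn a₀ b) ≤ (Literature.Probability.LatticeModels.prodBernoulli u).real (Literature.Probability.Percolation.openConn a₁ b) → (Literature.Probability.LatticeModels.prodBernoulli u).real (Literature.Probability.Percolation.openConn a₀ x ∩ Literature.Probability.Percolation.openConn a₁ b ∩ (Literature.Probability.Percolation.openConn a₀ b)ᶜ) ≤ (Literature.Probability.LatticeModels.prodBernoulli u).real (Literature.Probability.Percolation.openConn a₀ x ∩ Literature.Probability.Percolation.openConn a₀ b ∩ (Literature.Probability.Percolation.openConn a₁ b)ᶜ) + ((Literature.Probability.LatticeModels.prodBernoulli u).real (Literature.Probability.Percolation.openConn a₁ b) - (Literature.Probability.LatticeModels.prodBernoulli u).real (Literature.Probability.Percolation.openConn a₀ b)) * (Literature.Probability.LatticeModels.prodBernoulli u).real (Literature.Probability.Percolation.openConn a₀ x) :=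
  fun _ u a₀ a₁ b x hle => pairStepRelayExchange_hijack u a₀ a₁ b x hle

/-- Registered rung `stub_upsetExchangeNonneg_b` of crux stmt-CriticalPhenomena-4576 (seat b): nonnegativity of the localised exchange
slack for any event increasing in the open edge cluster of `a₁` — `pairStepRelayExchange_upset`, closed statement.
[cite: KozmaNitzan2024, Lemma 3(i) (pp. 6–7)] -/
theorem stub_upsetExchangeNonneg_b : ∀ (n : ℕ) (u : Sym2 (Fin n) → unitInterval) (a₀ a₁ b : Fin n) (Q : Set (Literature.Probability.Percolation.BondConfig (Fin n))), (∀ ω ω', ω ∈ Q → Literature.Probability.Percolation.openEdgeCluster ω a₁ ⊆ Literature.Probability.Percolation.openEdgeCluster ω' a₁ → ω' ∈ Q) → (Literature.Probability.LatticeModels.prodBernoulli u).real (Literature.Probability.Percolation.openConn a₀ b) ≤ (Literature.Probability.LatticeModels.prodBernoulli u).real (Literature.Probability.Percolation.openConn a₁ b) → (Literature.Probability.LatticeModels.prodBernoulli u).real (Q ∩ Literature.Probability.Percolation.openConn a₀ b ∩ (Literature.Probability.Percolation.openConn a₁ b)ᶜ) ≤ (Literature.Probability.LatticeModels.prodBernoulli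 u).real (Q ∩ Literature.Probability.Percolation.openConn a₁ b ∩ (Literature.Probability.Percolation.openConn a₀ b)ᶜ) :=
  fun _ u a₀ a₁ b Q hQ hle => pairStepRelayExchange_upset u a₀ a₁ b Q hQ hle

end PairStepRelayExchange

end

end Summit.CriticalPhenomena.PercolationContinuityZ3.Theorems
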